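import Literature.NumberTheory.Sieve.PairDivisorSumsShifted
import HarnessLib

/-!
# Divisor powers of `n` and `n + h` over rough `n` sharing a prime factor with `h`

Topic `Literature/NumberTheory/Sieve`.  Everything in this file is PROVED.  For exponents `a, b`, a shift
`1 ≤ h ≤ x^B` and a sieving level `2 ≤ z ≤ x^{1/4}`:

  `∑_{n ≤ x, (n,h) > 1, n z-rough, (n+h, P_h(z)) = 1} τ(n)^a τ(n+h)^b`
  `≤ C (h/φ(h)) · x/(z log² x) · (log x/log z)^κ`,

`C = C(a,b,B)`, `κ = κ(a,b,B)` (`PairDivisorSums.sum_pow_card_divisors_not_coprime_le`).  Compared with the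
sum over all rough `n` (`PairDivisorSums.sum_pow_card_divisors_shift_le`, of size
`(h/φ(h)) x (log x/log z)^{O(1)}/log² x`) the common prime factor with `h` — necessarily a prime `p ≥ z` —
saves a further factor `(log x/log z)/z`.

This is the estimate used twice by Matomäki–Merikoski (IMRN 2023; arXiv:2112.11412): in the proof of
Lemma 2.1 for "those `n` with `(n, h) > 1`" (p. 9–10 of the arXiv version, exponents `a = b = 2`, bound
`≪ (h/φ(h)) (X/log² X) u^{9+1}/z` before the outer `log X`), and as the first step of §5 (p. 16, replacing the
condition `(m₂n₂, P(z)) = 1` by `(m₂, hP(z)) = (n₂, P_h(z)) = 1` at the cost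
`≪ (h/φ(h)) (X/log² X) u⁶/z`, `a = b = 1`).  As in `PairDivisorSumsShifted.lean` the exponent `κ` here is
NOT the sharp one of the source (which rests on Henriot's form of the Nair–Tenenbaum bound): both uses in the
source tolerate any polynomial in `u = log X/log z` (the saving `1/z = X^{-1/u}` dominates).

## Proof (the source's, p. 9–10)

A rough `n ≤ x` with `(n, h) > 1` is `p k` with `p ∣ h`, `p ≥ z` prime; `τ(pk) ≤ 2τ(k)` and
`pk + h = p (k + h/p)`, and `k`, `k + h/p` inherit the roughness conditions (with the shift `h/p`).  For
`p ≤ x^{1/3}` the sum over `k ≤ x/p` is bounded by `sum_pow_card_divisors_shift_le`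
(`≪ (h/φ(h)) (x/p) (log x/log z)^{2κ₁}/log² z`), and `∑_{p ∣ h, p ≥ z} 1/p ≤ ω_{≥ z}(h)/z ≤ (log h/log z)/z`;
for `p > x^{1/3}` the crude bound `PairDivisorSums.crude_shifted_sum_le` (`≪ x^{2/3} (log x)^c`) and
`ω_{≥ z}(h) ≤ B log x/log z` suffice, since `z ≤ x^{1/4}`.

## References

* K. Matomäki, J. Merikoski, IMRN 2023:23, 20337–20384 (arXiv:2112.11412), proof of Lemma 2.1 (p. 9–10)
  and §5, first display of p. 16. [cite: MatomakiMerikoski2023, Lemma 2.1 (proof) and §5]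
* K. Henriot, Math. Proc. Cambridge Philos. Soc. 152 (2012) 405–424 (arXiv:1102.1643). [Henriot2012]
-/

noncomputable section

open Finset Real

namespace Literature.NumberTheory.Sieve

namespace PairDivisorSums

/-! ### Small tools -/

/-- `φ(pk) ≤ p φ(k)` for a prime `p`, in the form `k/φ(k) ≤ pk/φ(pk)`. [folklore] -/
theorem div_totient_le_div_totient_prime_mul {p k : ℕ} (hp : p.Prime) (hk : k ≠ 0) :
    (k : ℝ) / Nat.totient k ≤ ((p * k : ℕ) : ℝ) / Nat.totient (p * k) := by
  have hφk : 0 < Nat.totient k := Nat.totient_pos.mpr (Nat.pos_of_ne_zero hk)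
  have hφpk : 0 < Nat.totient (p * k) :=
    Nat.totient_pos.mpr (Nat.mul_pos hp.pos (Nat.pos_of_ne_zero hk))
  have hle : Nat.totient (p * k) ≤ p * Nat.totient k := by
    by_cases h : p ∣ k
    · rw [Nat.totient_mul_of_prime_of_dvd hp h]
    · rw [Nat.totient_mul_of_prime_of_not_dvd hp h]
      exact Nat.mul_le_mul_right _ (Nat.sub_le p 1)
  rw [div_le_div_iff₀ (by exact_mod_cast hφk) (by exact_mod_cast hφpk)]
  have hle' : ((Nat.totient (p * k) : ℕ) : ℝ) ≤ (p : ℝ) * (Nat.totient k : ℕ) := by exact_mod_cast hle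
  have hk0 : (0 : ℝ) ≤ k := Nat.cast_nonneg _
  push_cast
  nlinarith

/-- The number of prime factors `p ≥ z` of `h ≠ 0` is at most `log h/log z` (`z > 1`): their product
divides `h`. [folklore] -/
theorem card_primeFactors_ge_le {h : ℕ} (hh : h ≠ 0) {z : ℝ} (hz : 1 < z) :
    (#(h.primeFactors.filter (fun p : ℕ => z ≤ (p : ℝ))) : ℝ) ≤ Real.log h / Real.log z := by
  set P := h.primeFactors.filter (fun p : ℕ => z ≤ (p : ℝ)) with hP
  have hz0 : 0 < z := by linarith
  have hlz : 0 < Real.log z := Real.log_pos hz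
  -- `z^{#P} ≤ ∏_{p ∈ P} p ≤ h`
  have h1 : z ^ #P ≤ ∏ p ∈ P, (p : ℝ) := by
    rw [← Finset.prod_const]
    refine Finset.prod_le_prod (fun _ _ => hz0.le) fun p hp => ?_
    rw [hP, Finset.mem_filter] at hp
    exact hp.2
  have h2 : ∏ p ∈ P, (p : ℝ) ≤ h := by
    have hsub : P ⊆ h.primeFactors := Finset.filter_subset _ _
    have h3 : ∏ p ∈ P, p ∣ h :=
      (Finset.prod_dvd_prod_of_subset _ _ _ hsub).trans (Nat.prod_primeFactors_dvd h)
    have h4 : ∏ p ∈ P, p ≤ h := Nat.le_of_dvd (Nat.pos_of_ne_zero hh) h3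
    have h4' : ((∏ p ∈ P, p : ℕ) : ℝ) ≤ h := by exact_mod_cast h4
    rwa [Nat.cast_prod] at h4'
  have h5 := Real.log_le_log (by positivity) (h1.trans h2)
  rw [Real.log_pow] at h5
  rw [le_div_iff₀ hlz]
  exact h5

/-- `∑_{p ∣ h, p ≥ z} 1/p ≤ (log h/log z)/z`. [folklore] -/
theorem sum_primeFactors_ge_inv_le {h : ℕ} (hh : h ≠ 0) {z : ℝ} (hz : 1 < z) :
    ∑ p ∈ h.primeFactors.filter (fun p : ℕ => z ≤ (p : ℝ)), (1 : ℝ) / p ≤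
      Real.log h / Real.log z / z := by
  have hz0 : 0 < z := by linarith
  calc ∑ p ∈ h.primeFactors.filter (fun p : ℕ => z ≤ (p : ℝ)), (1 : ℝ) / p
      ≤ ∑ p ∈ h.primeFactors.filter (fun p : ℕ => z ≤ (p : ℝ)), (1 : ℝ) / z := by
        refine Finset.sum_le_sum fun p hp => ?_
        rw [Finset.mem_filter] at hp
        exact one_div_le_one_div_of_le hz0 hp.2
    _ = #(h.primeFactors.filter (fun p : ℕ => z ≤ (p : ℝ))) * (1 / z) := by
        rw [Finset.sum_const, nsmul_eq_mul]
    _ ≤ Real.log h / Real.log z * (1 / z) :=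
        mul_le_mul_of_nonneg_right (card_primeFactors_ge_le hh hz) (by positivity)
    _ = Real.log h / Real.log z / z := by ring

/-- Transfer of the roughness conditions from `n = pk` to `k`: if `pk` is `z`-rough and every prime factor
`< z` of `pk + h` divides `h = p h'`, where `p ≥ z`, then `k` is `z`-rough and every prime factor `< z` of
`k + h'` divides `h'`. [folklore] -/
theorem rough_of_rough_prime_mul {p k h' : ℕ} {z : ℝ} (hp : p.Prime) (hk : k ≠ 0) (hzp : z ≤ (p : ℝ))
    (h1 : ∀ r ∈ (p * k).primeFactors, z ≤ (r : ℝ))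
    (h2 : ∀ r ∈ (p * k + p * h').primeFactors, z ≤ (r : ℝ) ∨ r ∣ p * h') :
    (∀ r ∈ k.primeFactors, z ≤ (r : ℝ)) ∧ (∀ r ∈ (k + h').primeFactors, z ≤ (r : ℝ) ∨ r ∣ h') := by
  constructor
  · intro r hr
    refine h1 r ?_
    rw [Nat.primeFactors_mul hp.ne_zero hk]
    exact Finset.mem_union_right _ hr
  · intro r hr
    have hr' : r ∈ (p * k + p * h').primeFactors := by
      rw [← mul_add, Nat.primeFactors_mul hp.ne_zero (by omega)]
      exact Finset.mem_union_right _ hr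
    rcases h2 r hr' with h3 | h3
    · exact Or.inl h3
    · have hrp : r.Prime := Nat.prime_of_mem_primeFactors hr
      rcases (Nat.Prime.dvd_mul hrp).mp h3 with h4 | h4
      · left
        have : r = p := (Nat.prime_dvd_prime_iff_eq hrp hp).mp h4
        rw [this]; exact hzp
      · exact Or.inr h4

/-- `(log x)^m ≤ (12 m)^m x^{1/12}` for `x ≥ 1` (any fixed power of `log` is `O(x^{1/12})`). [folklore] -/
private theorem log_pow_le_mul_rpow_twelfth (m : ℕ) :
    ∃ K : ℝ, 0 < K ∧ ∀ x : ℝ, 1 ≤ x → Real.log x ^ m ≤ K * x ^ ((1 : ℝ) / 12) := by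
  rcases Nat.eq_zero_or_pos m with rfl | hm
  · refine ⟨1, one_pos, fun x hx => ?_⟩
    rw [pow_zero, one_mul]
    exact Real.one_le_rpow hx (by norm_num)
  refine ⟨(12 * (m : ℝ)) ^ m, by positivity, fun x hx => ?_⟩
  have hs : (0 : ℝ) < 1 / (12 * m) := by positivity
  have h1 : Real.log x ≤ x ^ (1 / (12 * (m : ℝ))) / (1 / (12 * m)) := Real.log_le_rpow_div (by linarith) hs
  have h2 : Real.log x ≤ (12 * m) * x ^ (1 / (12 * (m : ℝ))) := by
    rw [div_div_eq_mul_div, div_one] at h1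
    linarith
  have h0 : 0 ≤ Real.log x := Real.log_nonneg hx
  calc Real.log x ^ m ≤ ((12 * m) * x ^ (1 / (12 * (m : ℝ)))) ^ m := pow_le_pow_left₀ h0 h2 m
    _ = (12 * (m : ℝ)) ^ m * (x ^ (1 / (12 * (m : ℝ)))) ^ (m : ℕ) := by ring
    _ = (12 * (m : ℝ)) ^ m * x ^ ((1 : ℝ) / 12) := by
        rw [← Real.rpow_natCast (x ^ (1 / (12 * (m : ℝ)))) m, ← Real.rpow_mul (by linarith)]
        congr 2
        field_simp

/-! ### Reindexing the multiples of a prime factor of `h` -/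

/-- For a prime `p ∣ h` with `p ≥ z`: the part `p ∣ n` of the rough shifted divisor sum is at most
`2^{a+b}` times the same sum at scale `x/p` with shift `h/p`. [cite: MatomakiMerikoski2023, Lemma 2.1 (proof)] -/
theorem sum_filter_prime_dvd_le (a b : ℕ) {x h p : ℕ} {z : ℝ} (hp : p.Prime) (hph : p ∣ h)
    (hzp : z ≤ (p : ℝ)) :
    ∑ n ∈ ((Icc 1 x).filter (fun n : ℕ => (∀ r ∈ n.primeFactors, z ≤ (r : ℝ)) ∧
        (∀ r ∈ (n + h).primeFactors, z ≤ (r : ℝ) ∨ r ∣ h))).filter (fun n => p ∣ n),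
        ((n.divisors.card : ℝ)) ^ a * (((n + h).divisors.card : ℝ)) ^ b ≤
      2 ^ (a + b) * ∑ k ∈ (Icc 1 (x / p)).filter (fun k : ℕ => (∀ r ∈ k.primeFactors, z ≤ (r : ℝ)) ∧
        (∀ r ∈ (k + h / p).primeFactors, z ≤ (r : ℝ) ∨ r ∣ h / p)),
        ((k.divisors.card : ℝ)) ^ a * (((k + h / p).divisors.card : ℝ)) ^ b := by
  classical
  have hp0 : 0 < p := hp.pos
  have hphp : p * (h / p) = h := Nat.mul_div_cancel' hph
  set cond : ℕ → Prop := fun n : ℕ => (∀ r ∈ n.primeFactors, z ≤ (r : ℝ)) ∧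
    (∀ r ∈ (n + h).primeFactors, z ≤ (r : ℝ) ∨ r ∣ h) with hcond
  set cond' : ℕ → Prop := fun k : ℕ => (∀ r ∈ k.primeFactors, z ≤ (r : ℝ)) ∧
    (∀ r ∈ (k + h / p).primeFactors, z ≤ (r : ℝ) ∨ r ∣ h / p) with hcond'
  set F : ℕ → ℝ := fun n => ((n.divisors.card : ℝ)) ^ a * (((n + h).divisors.card : ℝ)) ^ b with hF
  set F' : ℕ → ℝ := fun k => ((k.divisors.card : ℝ)) ^ a * (((k + h / p).divisors.card : ℝ)) ^ b
    with hF'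
  have hF0 : ∀ n, 0 ≤ F n := fun n => by rw [hF]; positivity
  have hF'0 : ∀ k, 0 ≤ F' k := fun k => by rw [hF']; positivity
  -- rewrite both sides with indicator functions over the multiples of `p`
  have e1 : ∑ n ∈ ((Icc 1 x).filter cond).filter (fun n => p ∣ n), F n =
      ∑ n ∈ (Icc 1 x).filter (fun n => p ∣ n), (if cond n then F n else 0) := by
    rw [← Finset.sum_filter, Finset.filter_filter, Finset.filter_filter]
    refine Finset.sum_congr ?_ fun _ _ => rfl
    ext n
    simp only [Finset.mem_filter]
    tauto
  have e2 : ∑ k ∈ (Icc 1 (x / p)).filter cond', F' k =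
      ∑ k ∈ Icc 1 (x / p), (if cond' k then F' k else 0) := Finset.sum_filter _ _
  rw [e1, e2, sum_filter_dvd_eq hp0 x (fun n => if cond n then F n else 0), Finset.mul_sum]
  refine Finset.sum_le_sum fun k hk => ?_
  rw [Finset.mem_Icc] at hk
  have hk0 : k ≠ 0 := by omega
  by_cases hc : cond (p * k)
  · rw [if_pos hc]
    have hc' : cond' k := by
      rw [hcond] at hc
      obtain ⟨hc1, hc2⟩ := hc
      rw [← hphp] at hc2
      exact rough_of_rough_prime_mul hp hk0 hzp hc1 hc2
    rw [if_pos hc']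
    -- `τ(pk) ≤ 2τ(k)`, `pk + h = p(k + h/p)`
    have h1 : (((p * k).divisors.card : ℝ)) ≤ 2 * (k.divisors.card : ℝ) := by
      exact_mod_cast card_divisors_prime_mul_le hp k
    have h2 : (((p * k + h).divisors.card : ℝ)) ≤ 2 * ((k + h / p).divisors.card : ℝ) := by
      have : p * k + h = p * (k + h / p) := by rw [mul_add, hphp]
      rw [this]
      exact_mod_cast card_divisors_prime_mul_le hp (k + h / p)
    calc F (p * k) = (((p * k).divisors.card : ℝ)) ^ a * (((p * k + h).divisors.card : ℝ)) ^ b := by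
          rw [hF]
      _ ≤ (2 * (k.divisors.card : ℝ)) ^ a * (2 * ((k + h / p).divisors.card : ℝ)) ^ b :=
          mul_le_mul (pow_le_pow_left₀ (Nat.cast_nonneg _) h1 a)
            (pow_le_pow_left₀ (Nat.cast_nonneg _) h2 b) (by positivity) (by positivity)
      _ = 2 ^ (a + b) * F' k := by rw [hF', pow_add, mul_pow, mul_pow]; ring
  · rw [if_neg hc]
    refine mul_nonneg (by positivity) ?_
    split_ifs
    · exact hF'0 k
    · exact le_rfl

/-! ### The main bound -/

set_option maxHeartbeats 800000 in
/-- **Rough shifted divisor power sums over `n` sharing a prime factor with the shift**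
(Matomäki–Merikoski, proof of Lemma 2.1, "those `n` with `(n,h) > 1`", and the first step of §5; coarse
exponent).  For all `a b B : ℕ` there are `C > 0` and `κ : ℕ` such that for all naturals `x, h` and real
`z` with `2 ≤ z`, `z⁴ ≤ x`, `1 ≤ h ≤ x^B`:

`∑_{1 ≤ n ≤ x, (n,h) > 1, n z-rough, (∀ p ∣ n+h, p ≥ z ∨ p ∣ h)} τ(n)^a τ(n+h)^b`
`≤ C (h/φ(h)) x/(z (log x)²) (log x/log z)^κ`.
[cite: MatomakiMerikoski2023, Lemma 2.1 (proof, p. 9–10) and §5 (p. 16)] -/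
theorem sum_pow_card_divisors_not_coprime_le (a b B : ℕ) : ∃ C : ℝ, 0 < C ∧ ∃ κ : ℕ,
    ∀ (x h : ℕ) (z : ℝ), 2 ≤ z → z ^ 4 ≤ (x : ℝ) → 1 ≤ h → (h : ℝ) ≤ (x : ℝ) ^ B →
      ∑ n ∈ (Icc 1 x).filter (fun n : ℕ => ¬ Nat.Coprime n h ∧ (∀ p ∈ n.primeFactors, z ≤ (p : ℝ)) ∧
          (∀ p ∈ (n + h).primeFactors, z ≤ (p : ℝ) ∨ p ∣ h)),
        ((n.divisors.card : ℝ)) ^ a * (((n + h).divisors.card : ℝ)) ^ b ≤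
      C * ((h : ℝ) / Nat.totient h) * (x : ℝ) / (z * Real.log x ^ 2) * (Real.log x / Real.log z) ^ κ := by
  obtain ⟨C₁, hC₁, κ₁, H₁⟩ := sum_pow_card_divisors_shift_le a b (3 * B)
  obtain ⟨C₂, hC₂, c, H₂⟩ := crude_shifted_sum_le a b B
  obtain ⟨K, hK, hKb⟩ := log_pow_le_mul_rpow_twelfth (c + 2)
  obtain ⟨κ, hκ⟩ : ∃ κ : ℕ, κ = 2 * κ₁ + 3 := ⟨_, rfl⟩
  obtain ⟨Csm, hCsm⟩ : ∃ C : ℝ, C = 2 ^ (a + b) * C₁ * ((B : ℝ) + 1) := ⟨_, rfl⟩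
  obtain ⟨Clg, hClg⟩ : ∃ C : ℝ, C = 2 ^ (a + b) * (4 * C₂ * K) * ((B : ℝ) + 1) := ⟨_, rfl⟩
  have hCsm0 : 0 < Csm := by rw [hCsm]; positivity
  have hClg0 : 0 < Clg := by rw [hClg]; positivity
  refine ⟨Csm + Clg, by positivity, κ, ?_⟩
  intro x h z hz hzx hh hhB
  classical
  -- names and basic facts
  set A := (Icc 1 x).filter (fun n : ℕ => ¬ Nat.Coprime n h ∧ (∀ p ∈ n.primeFactors, z ≤ (p : ℝ)) ∧
      (∀ p ∈ (n + h).primeFactors, z ≤ (p : ℝ) ∨ p ∣ h)) with hA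
  set A' := (Icc 1 x).filter (fun n : ℕ => (∀ r ∈ n.primeFactors, z ≤ (r : ℝ)) ∧
      (∀ r ∈ (n + h).primeFactors, z ≤ (r : ℝ) ∨ r ∣ h)) with hA'
  set Fτ : ℕ → ℝ := fun n => ((n.divisors.card : ℝ)) ^ a * (((n + h).divisors.card : ℝ)) ^ b with hFτ
  set P := h.primeFactors.filter (fun p : ℕ => z ≤ (p : ℝ)) with hP
  obtain ⟨Fφ, hFφ⟩ : ∃ F : ℝ, F = (h : ℝ) / Nat.totient h := ⟨_, rfl⟩
  obtain ⟨u, hu⟩ : ∃ u : ℝ, u = Real.log x / Real.log z := ⟨_, rfl⟩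
  have hh0 : h ≠ 0 := by omega
  have hz0 : 0 < z := by linarith
  have hz1 : 1 < z := by linarith
  have hz2 : (4 : ℝ) ≤ z ^ 2 := by nlinarith
  have hz16 : (16 : ℝ) ≤ z ^ 4 := by nlinarith [hz2]
  have hx16 : (16 : ℝ) ≤ x := hz16.trans hzx
  have hx16' : 16 ≤ x := by exact_mod_cast hx16
  have hx0 : (0 : ℝ) < x := by linarith
  have hx1 : (1 : ℝ) ≤ x := by linarith
  have hzz4 : z ≤ z ^ 4 := by
    calc z = z ^ 1 := (pow_one z).symm
      _ ≤ z ^ 4 := pow_le_pow_right₀ hz1.le (by norm_num)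
  have hzx' : z ≤ x := hzz4.trans hzx
  have hlogz : 0 < Real.log z := Real.log_pos hz1
  have hlogx : 0 < Real.log x := Real.log_pos (by linarith)
  have hlogzx : Real.log z ≤ Real.log x := Real.log_le_log hz0 hzx'
  have hu1 : 1 ≤ u := by rw [hu, le_div_iff₀ hlogz, one_mul]; exact hlogzx
  have hu0 : 0 < u := by linarith
  have hφpos : (0 : ℝ) < Nat.totient h := by exact_mod_cast Nat.totient_pos.mpr (by omega)
  have hFφ1 : 1 ≤ Fφ := by
    rw [hFφ, le_div_iff₀ hφpos, one_mul]; exact_mod_cast Nat.totient_le h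
  have hFτ0 : ∀ n, 0 ≤ Fτ n := fun n => by rw [hFτ]; positivity
  have hlogh : Real.log h ≤ (B : ℝ) * Real.log x := by
    have := Real.log_le_log (by exact_mod_cast (show 0 < h by omega)) hhB
    rwa [Real.log_pow] at this
  -- `z ≤ x^{1/4}` in the forms used below
  have hz4 : z ≤ (x : ℝ) ^ ((1 : ℝ) / 4) := by
    have : z = (z ^ (4 : ℕ)) ^ ((1 : ℝ) / 4) := by
      rw [← Real.rpow_natCast z 4, ← Real.rpow_mul hz0.le]; norm_num
    rw [this]
    exact Real.rpow_le_rpow (by positivity) hzx (by norm_num)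
  -- the target quantity
  obtain ⟨Φ, hΦ⟩ : ∃ Φ : ℝ, Φ = Fφ * (x : ℝ) / (z * Real.log x ^ 2) * u ^ κ := ⟨_, rfl⟩
  have hΦ0 : 0 < Φ := by rw [hΦ]; positivity
  -- (1) domination by the sum over `p ∈ P`, `p ∣ n`
  have hdom : ∀ n ∈ A, Fτ n ≤ ∑ p ∈ P, if p ∣ n then Fτ n else 0 := by
    intro n hn
    rw [hA, Finset.mem_filter, Finset.mem_Icc] at hn
    obtain ⟨⟨hn1, -⟩, hncop, hr1, -⟩ := hn
    have hg1 : Nat.gcd n h ≠ 1 := hncop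
    have hp : (Nat.gcd n h).minFac.Prime := Nat.minFac_prime hg1
    have hpg : (Nat.gcd n h).minFac ∣ Nat.gcd n h := Nat.minFac_dvd _
    have hpn : (Nat.gcd n h).minFac ∣ n := hpg.trans (Nat.gcd_dvd_left n h)
    have hph : (Nat.gcd n h).minFac ∣ h := hpg.trans (Nat.gcd_dvd_right n h)
    have hpP : (Nat.gcd n h).minFac ∈ P := by
      rw [hP, Finset.mem_filter, Nat.mem_primeFactors]
      exact ⟨⟨hp, hph, hh0⟩, hr1 _ (Nat.mem_primeFactors.mpr ⟨hp, hpn, by omega⟩)⟩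
    calc Fτ n = if (Nat.gcd n h).minFac ∣ n then Fτ n else 0 := by rw [if_pos hpn]
      _ ≤ ∑ p ∈ P, if p ∣ n then Fτ n else 0 :=
          Finset.single_le_sum (f := fun p => if p ∣ n then Fτ n else 0)
            (fun q _ => by
              show (0 : ℝ) ≤ if q ∣ n then _ else 0
              split_ifs
              · exact hFτ0 n
              · exact le_rfl) hpP
  -- (2) for each `p ∈ P`: restriction to `A'` and reindexing
  have hstep : ∀ p ∈ P, ∑ n ∈ A, (if p ∣ n then Fτ n else 0) ≤
      2 ^ (a + b) * ∑ k ∈ (Icc 1 (x / p)).filter (fun k : ℕ => (∀ r ∈ k.primeFactors, z ≤ (r : ℝ)) ∧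
        (∀ r ∈ (k + h / p).primeFactors, z ≤ (r : ℝ) ∨ r ∣ h / p)),
        ((k.divisors.card : ℝ)) ^ a * (((k + h / p).divisors.card : ℝ)) ^ b := by
    intro p hp
    rw [hP, Finset.mem_filter, Nat.mem_primeFactors] at hp
    obtain ⟨⟨hpp, hph, -⟩, hpz⟩ := hp
    have h1 : ∑ n ∈ A, (if p ∣ n then Fτ n else 0) ≤ ∑ n ∈ A'.filter (fun n => p ∣ n), Fτ n := by
      rw [← Finset.sum_filter]
      refine Finset.sum_le_sum_of_subset_of_nonneg ?_ fun n _ _ => hFτ0 n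
      intro n hn
      rw [Finset.mem_filter, hA, Finset.mem_filter] at hn
      rw [Finset.mem_filter, hA', Finset.mem_filter]
      exact ⟨⟨hn.1.1, hn.1.2.2⟩, hn.2⟩
    exact h1.trans (sum_filter_prime_dvd_le a b hpp hph hpz)
  -- (3) small primes `p³ ≤ x`: the shifted rough sum at scale `x/p`
  have hsmall : ∀ p ∈ P, (p : ℝ) ^ 3 ≤ x →
      ∑ k ∈ (Icc 1 (x / p)).filter (fun k : ℕ => (∀ r ∈ k.primeFactors, z ≤ (r : ℝ)) ∧
        (∀ r ∈ (k + h / p).primeFactors, z ≤ (r : ℝ) ∨ r ∣ h / p)),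
        ((k.divisors.card : ℝ)) ^ a * (((k + h / p).divisors.card : ℝ)) ^ b ≤
      C₁ * Fφ * ((x : ℝ) / p) / Real.log z ^ 2 * u ^ (2 * κ₁) := by
    intro p hp hp3
    rw [hP, Finset.mem_filter, Nat.mem_primeFactors] at hp
    obtain ⟨⟨hpp, hph, -⟩, hpz⟩ := hp
    have hp0 : 0 < p := hpp.pos
    have hp0' : (0 : ℝ) < p := by exact_mod_cast hp0
    have hp2 : 2 ≤ p := hpp.two_le
    set y := x / p with hy
    -- `p² ≤ y`, `4 ≤ y`, `x < p (y + 1) ≤ y³`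
    have hp3' : p ^ 3 ≤ x := by exact_mod_cast hp3
    have hpy : p * p ≤ y := by
      rw [hy, Nat.le_div_iff_mul_le hp0]
      calc p * p * p = p ^ 3 := by ring
        _ ≤ x := hp3'
    have hy4 : 4 ≤ y := le_trans (Nat.mul_le_mul hp2 hp2) hpy
    have hxlt : x < p * (y + 1) := by
      rw [hy, mul_add, mul_one, mul_comm]
      exact Nat.lt_div_mul_add hp0
    have hpy' : p ≤ y := le_trans (Nat.le_mul_of_pos_right p hp0) hpy
    have hxy3 : (x : ℝ) ≤ (y : ℝ) ^ 3 := by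
      have h1 : (x : ℝ) < (p : ℝ) * ((y : ℝ) + 1) := by exact_mod_cast hxlt
      have h2 : (p : ℝ) ≤ y := by exact_mod_cast hpy'
      have h3 : (4 : ℝ) ≤ y := by exact_mod_cast hy4
      have h4 : (p : ℝ) * ((y : ℝ) + 1) ≤ (y : ℝ) * ((y : ℝ) + 1) :=
        mul_le_mul_of_nonneg_right h2 (by positivity)
      have h5 : (y : ℝ) * ((y : ℝ) + 1) ≤ (y : ℝ) ^ 3 := by nlinarith
      linarith
    have hy2 : 2 ≤ y := by omega
    have hy1 : (1 : ℝ) ≤ y := by exact_mod_cast (show 1 ≤ y by omega)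
    -- hypotheses of the shifted bound at scale `y` with shift `h/p`
    have hh' : 1 ≤ h / p := Nat.div_pos (Nat.le_of_dvd (by omega) hph) hp0
    have hh'B : ((h / p : ℕ) : ℝ) ≤ (y : ℝ) ^ (3 * B) := by
      calc ((h / p : ℕ) : ℝ) ≤ h := by exact_mod_cast Nat.div_le_self h p
        _ ≤ (x : ℝ) ^ B := hhB
        _ ≤ ((y : ℝ) ^ 3) ^ B := pow_le_pow_left₀ hx0.le hxy3 B
        _ = (y : ℝ) ^ (3 * B) := by rw [← pow_mul]
    have hzy : z ≤ (y : ℝ) := by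
      by_contra hcon
      rw [not_le] at hcon
      have h1 : (y : ℝ) ^ 4 < z ^ 4 := by
        have := pow_lt_pow_left₀ hcon (by positivity) (show (4 : ℕ) ≠ 0 by norm_num)
        exact this
      have h3 : (4 : ℝ) ≤ y := by exact_mod_cast hy4
      nlinarith
    have hmain := H₁ y (h / p) hy2 hh' hh'B z z hz hzy hz hzy
    -- compare with the claimed shape
    have hyx : (y : ℝ) ≤ (x : ℝ) / p := by
      rw [hy]; exact Nat.cast_div_le
    have hlogy : Real.log y ≤ Real.log x := by
      refine Real.log_le_log (by positivity) (hyx.trans (div_le_self hx0.le ?_))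
      exact_mod_cast hp0
    have hlogy0 : 0 ≤ Real.log y := Real.log_nonneg hy1
    have hratio : Real.log y / Real.log z ≤ u := by
      rw [hu]; exact div_le_div_of_nonneg_right hlogy hlogz.le
    have hratio0 : 0 ≤ Real.log y / Real.log z := by positivity
    have hφ' : ((h / p : ℕ) : ℝ) / Nat.totient (h / p) ≤ Fφ := by
      have := div_totient_le_div_totient_prime_mul hpp (k := h / p) (by omega)
      rw [Nat.mul_div_cancel' hph] at this
      rw [hFφ]; exact this
    have hφ'0 : 0 ≤ ((h / p : ℕ) : ℝ) / Nat.totient (h / p) := by positivity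
    calc _ ≤ C₁ * (((h / p : ℕ) : ℝ) / Nat.totient (h / p)) * (y : ℝ) / (Real.log z * Real.log z) *
          ((Real.log y / Real.log z) ^ κ₁ * (Real.log y / Real.log z) ^ κ₁) := hmain
      _ = C₁ * ((((h / p : ℕ) : ℝ) / Nat.totient (h / p)) * (y : ℝ) *
          (Real.log y / Real.log z) ^ (2 * κ₁)) / Real.log z ^ 2 := by
          rw [two_mul, pow_add]; ring
      _ ≤ C₁ * (Fφ * ((x : ℝ) / p) * u ^ (2 * κ₁)) / Real.log z ^ 2 := by
          refine div_le_div_of_nonneg_right (mul_le_mul_of_nonneg_left ?_ hC₁.le) (by positivity)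
          exact mul_le_mul (mul_le_mul hφ' hyx (by positivity) (by linarith))
            (pow_le_pow_left₀ hratio0 hratio _) (by positivity) (by positivity)
      _ = C₁ * Fφ * ((x : ℝ) / p) / Real.log z ^ 2 * u ^ (2 * κ₁) := by ring
  -- (4) large primes `p³ > x`: the crude bound
  have hlarge : ∀ p ∈ P, (x : ℝ) < (p : ℝ) ^ 3 →
      ∑ k ∈ (Icc 1 (x / p)).filter (fun k : ℕ => (∀ r ∈ k.primeFactors, z ≤ (r : ℝ)) ∧
        (∀ r ∈ (k + h / p).primeFactors, z ≤ (r : ℝ) ∨ r ∣ h / p)),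
        ((k.divisors.card : ℝ)) ^ a * (((k + h / p).divisors.card : ℝ)) ^ b ≤
      4 * C₂ * (x : ℝ) ^ ((2 : ℝ) / 3) * Real.log x ^ c := by
    intro p hp hp3
    rw [hP, Finset.mem_filter, Nat.mem_primeFactors] at hp
    obtain ⟨⟨hpp, hph, -⟩, hpz⟩ := hp
    have hp0 : 0 < p := hpp.pos
    have hp0' : (0 : ℝ) < p := by exact_mod_cast hp0
    have hh' : 1 ≤ h / p := Nat.div_pos (Nat.le_of_dvd (by omega) hph) hp0
    have hh'B : ((h / p : ℕ) : ℝ) ≤ (x : ℝ) ^ B := le_trans (by exact_mod_cast Nat.div_le_self h p) hhB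
    have h1 : ∑ k ∈ (Icc 1 (x / p)).filter (fun k : ℕ => (∀ r ∈ k.primeFactors, z ≤ (r : ℝ)) ∧
        (∀ r ∈ (k + h / p).primeFactors, z ≤ (r : ℝ) ∨ r ∣ h / p)),
        ((k.divisors.card : ℝ)) ^ a * (((k + h / p).divisors.card : ℝ)) ^ b ≤
        ∑ k ∈ Icc 1 (x / p), ((k.divisors.card : ℝ)) ^ a * (((k + h / p).divisors.card : ℝ)) ^ b :=
      Finset.sum_le_sum_of_subset_of_nonneg (Finset.filter_subset _ _) fun k _ _ => by positivity
    have h2 := H₂ x (h / p) (x / p) (by omega) hh' hh'B (Nat.div_le_self x p)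
    -- `x/p ≤ x^{2/3}` and `√x ≤ x^{2/3}`
    have hp13 : (x : ℝ) ^ ((1 : ℝ) / 3) < p := by
      by_contra hcon
      rw [not_lt] at hcon
      have : (p : ℝ) ^ 3 ≤ x := by
        have e : ((x : ℝ) ^ ((1 : ℝ) / 3)) ^ (3 : ℕ) = x := by
          rw [← Real.rpow_natCast, ← Real.rpow_mul hx0.le]; norm_num
        calc (p : ℝ) ^ 3 ≤ ((x : ℝ) ^ ((1 : ℝ) / 3)) ^ 3 := pow_le_pow_left₀ hp0'.le hcon 3
          _ = x := e
      linarith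
    have hx13 : 0 < (x : ℝ) ^ ((1 : ℝ) / 3) := by positivity
    have hyx : (((x / p : ℕ) : ℝ)) ≤ (x : ℝ) ^ ((2 : ℝ) / 3) := by
      calc (((x / p : ℕ) : ℝ)) ≤ (x : ℝ) / p := Nat.cast_div_le
        _ ≤ (x : ℝ) / (x : ℝ) ^ ((1 : ℝ) / 3) := div_le_div_of_nonneg_left hx0.le hx13 hp13.le
        _ = (x : ℝ) ^ ((2 : ℝ) / 3) := by
            rw [div_eq_iff hx13.ne', ← Real.rpow_add hx0]; norm_num
    have hsqrt : Real.sqrt x ≤ (x : ℝ) ^ ((2 : ℝ) / 3) := by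
      rw [Real.sqrt_eq_rpow]
      exact Real.rpow_le_rpow_of_exponent_le hx1 (by norm_num)
    calc _ ≤ _ := h1
      _ ≤ C₂ * ((((x / p : ℕ) : ℝ)) + Real.sqrt x) * Real.log x ^ c := h2
      _ ≤ C₂ * ((x : ℝ) ^ ((2 : ℝ) / 3) + (x : ℝ) ^ ((2 : ℝ) / 3)) * Real.log x ^ c := by
          refine mul_le_mul_of_nonneg_right (mul_le_mul_of_nonneg_left (add_le_add hyx hsqrt) hC₂.le)
            (by positivity)
      _ ≤ 4 * C₂ * (x : ℝ) ^ ((2 : ℝ) / 3) * Real.log x ^ c := by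
          have : 0 ≤ C₂ * (x : ℝ) ^ ((2 : ℝ) / 3) * Real.log x ^ c := by positivity
          nlinarith
  -- (5) the number of primes in `P` and the sum of their reciprocals
  have hPcard : (#P : ℝ) ≤ (B : ℝ) * u := by
    refine (card_primeFactors_ge_le hh0 hz1).trans ?_
    rw [hu, ← mul_div_assoc]
    exact div_le_div_of_nonneg_right hlogh hlogz.le
  have hPinv : ∑ p ∈ P, (1 : ℝ) / p ≤ (B : ℝ) * u / z := by
    refine (sum_primeFactors_ge_inv_le hh0 hz1).trans ?_
    refine div_le_div_of_nonneg_right ?_ hz0.le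
    rw [hu, ← mul_div_assoc]
    exact div_le_div_of_nonneg_right hlogh hlogz.le
  -- (6) the two absorptions into `Φ`
  have habs_small : C₁ * Fφ * (x : ℝ) / Real.log z ^ 2 * u ^ (2 * κ₁) * ((B : ℝ) * u / z) ≤
      C₁ * ((B : ℝ) + 1) * Φ := by
    have e1 : Real.log z = Real.log x / u := by
      rw [hu]; field_simp
    have e2 : C₁ * Fφ * (x : ℝ) / Real.log z ^ 2 * u ^ (2 * κ₁) * ((B : ℝ) * u / z) =
        C₁ * (B : ℝ) * (Fφ * (x : ℝ) / (z * Real.log x ^ 2) * u ^ (2 * κ₁ + 3)) := by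
      rw [e1]
      field_simp
      ring
    have e3 : C₁ * ((B : ℝ) + 1) * Φ = C₁ * ((B : ℝ) + 1) *
        (Fφ * (x : ℝ) / (z * Real.log x ^ 2) * u ^ (2 * κ₁ + 3)) := by rw [hΦ, hκ]
    rw [e2, e3]
    refine mul_le_mul_of_nonneg_right ?_ (by positivity)
    exact mul_le_mul_of_nonneg_left (by linarith) hC₁.le
  have habs_large : ((B : ℝ) * u) * (4 * C₂ * (x : ℝ) ^ ((2 : ℝ) / 3) * Real.log x ^ c) ≤
      4 * C₂ * K * ((B : ℝ) + 1) * Φ := by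
    -- `z (log x)^{c+2} x^{2/3} ≤ K x`, `1 ≤ Fφ`, `u ≤ u^κ`
    have hK' := hKb x hx1
    have h1 : z * (x : ℝ) ^ ((2 : ℝ) / 3) * Real.log x ^ (c + 2) ≤ K * x := by
      calc z * (x : ℝ) ^ ((2 : ℝ) / 3) * Real.log x ^ (c + 2)
          ≤ (x : ℝ) ^ ((1 : ℝ) / 4) * (x : ℝ) ^ ((2 : ℝ) / 3) * (K * (x : ℝ) ^ ((1 : ℝ) / 12)) :=
            mul_le_mul (mul_le_mul_of_nonneg_right hz4 (by positivity)) hK' (by positivity)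
              (by positivity)
        _ = K * ((x : ℝ) ^ ((1 : ℝ) / 4) * (x : ℝ) ^ ((2 : ℝ) / 3) * (x : ℝ) ^ ((1 : ℝ) / 12)) := by
            ring
        _ = K * x := by
            rw [← Real.rpow_add hx0, ← Real.rpow_add hx0]
            norm_num
    have huκ : u ≤ u ^ κ := by
      calc u = u ^ 1 := (pow_one u).symm
        _ ≤ u ^ κ := pow_le_pow_right₀ hu1 (by rw [hκ]; omega)
    have h2 : u * ((x : ℝ) ^ ((2 : ℝ) / 3) * Real.log x ^ c) ≤ K * Φ := by
      rw [hΦ]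
      have e : K * (Fφ * (x : ℝ) / (z * Real.log x ^ 2) * u ^ κ) =
          (K * x) * Fφ * u ^ κ / (z * Real.log x ^ 2) := by ring
      rw [e, le_div_iff₀ (by positivity)]
      calc u * ((x : ℝ) ^ ((2 : ℝ) / 3) * Real.log x ^ c) * (z * Real.log x ^ 2)
          = (z * (x : ℝ) ^ ((2 : ℝ) / 3) * Real.log x ^ (c + 2)) * 1 * u := by ring
        _ ≤ (K * x) * Fφ * u ^ κ :=
            mul_le_mul (mul_le_mul h1 hFφ1 zero_le_one (by positivity)) huκ hu0.le (by positivity)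
    have e2 : ((B : ℝ) * u) * (4 * C₂ * (x : ℝ) ^ ((2 : ℝ) / 3) * Real.log x ^ c) =
        4 * C₂ * (B : ℝ) * (u * ((x : ℝ) ^ ((2 : ℝ) / 3) * Real.log x ^ c)) := by ring
    rw [e2]
    calc 4 * C₂ * (B : ℝ) * (u * ((x : ℝ) ^ ((2 : ℝ) / 3) * Real.log x ^ c))
        ≤ 4 * C₂ * (B : ℝ) * (K * Φ) := mul_le_mul_of_nonneg_left h2 (by positivity)
      _ ≤ 4 * C₂ * ((B : ℝ) + 1) * (K * Φ) := by
          refine mul_le_mul_of_nonneg_right ?_ (by positivity)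
          exact mul_le_mul_of_nonneg_left (by linarith) (by positivity)
      _ = 4 * C₂ * K * ((B : ℝ) + 1) * Φ := by ring
  -- (7) assembly
  have hsplit : ∀ p ∈ P, ∑ n ∈ A, (if p ∣ n then Fτ n else 0) ≤
      2 ^ (a + b) * (C₁ * Fφ * (x : ℝ) / Real.log z ^ 2 * u ^ (2 * κ₁) * ((1 : ℝ) / p)) +
        2 ^ (a + b) * (4 * C₂ * (x : ℝ) ^ ((2 : ℝ) / 3) * Real.log x ^ c) := by
    intro p hp
    refine (hstep p hp).trans ?_
    have hT1 : 0 ≤ 2 ^ (a + b) * (C₁ * Fφ * (x : ℝ) / Real.log z ^ 2 * u ^ (2 * κ₁) * ((1 : ℝ) / p)) := by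
      positivity
    have hT2 : 0 ≤ 2 ^ (a + b) * (4 * C₂ * (x : ℝ) ^ ((2 : ℝ) / 3) * Real.log x ^ c) := by positivity
    rcases le_or_gt ((p : ℝ) ^ 3) (x : ℝ) with h3 | h3
    · have := hsmall p hp h3
      have e : C₁ * Fφ * ((x : ℝ) / p) / Real.log z ^ 2 * u ^ (2 * κ₁) =
          C₁ * Fφ * (x : ℝ) / Real.log z ^ 2 * u ^ (2 * κ₁) * ((1 : ℝ) / p) := by ring
      rw [e] at this
      linarith [mul_le_mul_of_nonneg_left this (show (0 : ℝ) ≤ 2 ^ (a + b) by positivity)]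
    · have := hlarge p hp h3
      linarith [mul_le_mul_of_nonneg_left this (show (0 : ℝ) ≤ 2 ^ (a + b) by positivity)]
  calc ∑ n ∈ A, Fτ n ≤ ∑ n ∈ A, ∑ p ∈ P, (if p ∣ n then Fτ n else 0) := Finset.sum_le_sum hdom
    _ = ∑ p ∈ P, ∑ n ∈ A, (if p ∣ n then Fτ n else 0) := Finset.sum_comm
    _ ≤ ∑ p ∈ P, (2 ^ (a + b) * (C₁ * Fφ * (x : ℝ) / Real.log z ^ 2 * u ^ (2 * κ₁) * ((1 : ℝ) / p)) +
          2 ^ (a + b) * (4 * C₂ * (x : ℝ) ^ ((2 : ℝ) / 3) * Real.log x ^ c)) := Finset.sum_le_sum hsplit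
    _ = 2 ^ (a + b) * (C₁ * Fφ * (x : ℝ) / Real.log z ^ 2 * u ^ (2 * κ₁)) * ∑ p ∈ P, (1 : ℝ) / p +
          #P * (2 ^ (a + b) * (4 * C₂ * (x : ℝ) ^ ((2 : ℝ) / 3) * Real.log x ^ c)) := by
        rw [Finset.sum_add_distrib, Finset.sum_const, nsmul_eq_mul, Finset.mul_sum]
        congr 1
        refine Finset.sum_congr rfl fun p _ => ?_
        ring
    _ ≤ 2 ^ (a + b) * (C₁ * Fφ * (x : ℝ) / Real.log z ^ 2 * u ^ (2 * κ₁)) * ((B : ℝ) * u / z) +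
          ((B : ℝ) * u) * (2 ^ (a + b) * (4 * C₂ * (x : ℝ) ^ ((2 : ℝ) / 3) * Real.log x ^ c)) := by
        refine add_le_add (mul_le_mul_of_nonneg_left hPinv (by positivity))
          (mul_le_mul_of_nonneg_right hPcard (by positivity))
    _ = 2 ^ (a + b) * (C₁ * Fφ * (x : ℝ) / Real.log z ^ 2 * u ^ (2 * κ₁) * ((B : ℝ) * u / z)) +
          2 ^ (a + b) * (((B : ℝ) * u) * (4 * C₂ * (x : ℝ) ^ ((2 : ℝ) / 3) * Real.log x ^ c)) := by
        ring
    _ ≤ 2 ^ (a + b) * (C₁ * ((B : ℝ) + 1) * Φ) + 2 ^ (a + b) * (4 * C₂ * K * ((B : ℝ) + 1) * Φ) :=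
        add_le_add (mul_le_mul_of_nonneg_left habs_small (by positivity))
          (mul_le_mul_of_nonneg_left habs_large (by positivity))
    _ = (Csm + Clg) * Φ := by rw [hCsm, hClg]; ring
    _ = (Csm + Clg) * ((h : ℝ) / Nat.totient h) * (x : ℝ) / (z * Real.log x ^ 2) *
          (Real.log x / Real.log z) ^ κ := by rw [hΦ, hFφ, hu]; ring

end PairDivisorSums

end Literature.NumberTheory.Sieve
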